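import Mathlib
import Literature.NumberTheory.Irrationality.BrownZudilin2022.CubicalForm
import Summits.KontsevichZagierPeriods.Zeta5Search.JintegralEulerSymmetry
import Summits.KontsevichZagierPeriods.Zeta5Search.JintegralEulerTheta
import Summits.KontsevichZagierPeriods.Zeta5Search.CellularIntegralInvolution
import HarnessLib

/-!
# ζ(5) search — the symmetry `p₁₂` beyond the chamber, and (27) for the whole 'trivial' group `⟨i₁, p₀₁, p₁₂⟩`
(cell `pub-zeta5`, seat ct-1 g12)

HONEST FRAMING: systematic search; no irrationality claim unless kernel-certified. Nothing in this file is an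
irrationality result, a worthiness exponent or a denominator statement; identities between Brown–Zudilin's real
integrals only. [BrownZudilin2022, Sect. 7, first half: "the symmetry of the parameters `p₁+1` and `p₂+1` in the
₃F₂-representation implies …"] — proved here on the five-fold integral (10) itself, with no Barnes integral and no chamber:

* `Jintegral_p12` — `J(p₁₂(p;q))·q₁!q₂! = J(p;q)·(p₁+q₁−p₂)!(p₂+q₂−p₁)!` for ALL `(p;q)` with
  `q₁, q₂, p₁+q₁−p₂, p₂+q₂−p₁ ≥ 0` (no condition on `p₀,…,p₆, q₃, q₄, q₅`; both sides junk `0` together when divergent):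
  after the fibration change of variables `Θ` of `JintegralEulerTheta.lean` both integrands are Euler kernels in the
  fibre variable (`α = P`, `β = 1−P`) and `EulerKernelSymmetry.euler_symmetry` + the slice lemma
  `JintegralEulerSymmetry.setIntegral_openCube_eq_of_slices` conclude;
* `cellularIntegral_genP12`, `normalisedIntegral'_genP12` — the `p₁₂`-conjunct of the named fact
  `invariance_of_converges'` ((27)) EXACTLY as typed (for `a`, `p₁₂ a` convergent; the four sign conditions are
  convergence forms of `a` or `p₁₂ a`; `p₀(a) = h₁₉(a)` of either sign);
* `Jintegral_p45`, `Jintegral_p56` — the `i₁`-conjugates on the `t`-side, likewise without chamber; with `CubicalForm.Jintegral_reverse`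
  (`i₁`) and `JintegralEulerSymmetry.Jintegral_p01` all five generators of the 'trivial' group of order 72 acting on
  `J(p;q)/(p₁!p₂!p₄!p₅!q₁!q₂!q₄!q₅!)` are now theorems about the integral (10) with sign hypotheses only;
* `invariance_of_converges'_trivial_group` — the `i₁`-, `p₀₁`-, `p₁₂`-conjuncts of `invariance_of_converges'` together
  (with `CellularIntegralInvolution.normalisedIntegral'_genI1`, `JintegralEulerSymmetry.normalisedIntegral'_genP01`);
* `invariance_of_converges'_of_h_h'` — the named fact REDUCED to its two Bailey generators `h`, `h'`: what remains of
  (27) is exactly Brown–Zudilin's use of Bailey's `₇F₆` transformation [Bailey §6.3 (2)] (Sect. 7, second half).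

Theorems only (no new definitions).
-/

noncomputable section

namespace Summit.KontsevichZagierPeriods.Zeta5Search.JintegralEulerP12

open MeasureTheory Set Filter
open scoped ENNReal Nat
open Literature.NumberTheory.Irrationality.BrownZudilin2022
open Summit.KontsevichZagierPeriods.Zeta5Search.CubicalSubstitution (measurableSet_openCube)
open Summit.KontsevichZagierPeriods.Zeta5Search.CellularCubicalSubstitution (cellularIntegral_eq_Jintegral)
open Summit.KontsevichZagierPeriods.Zeta5Search.BarnesSymmetry (normF_pos pOf_genP12 qOf_genP12 normF_genP12)
open Summit.KontsevichZagierPeriods.Zeta5Search.EulerKernelSymmetry (euler_symmetry)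
open Summit.KontsevichZagierPeriods.Zeta5Search.JintegralEulerSymmetry
open Summit.KontsevichZagierPeriods.Zeta5Search.JintegralEulerTheta

/-- The transformed integrand `|det Θ'| · integrandJ ∘ Θ` is measurable. -/
theorem measurable_thetaIntegrand (p : Fin 7 → ℤ) (q : Fin 5 → ℤ) :
    Measurable (fun z : Fin 5 → ℝ => (1 - z 1) / (z 1 + (1 - z 1) * z 0) *
      integrandJ p q ![z 1 + (1 - z 1) * z 0, z 1 / (z 1 + (1 - z 1) * z 0), z 2, z 3, z 4]) := by
  have h1 : Measurable fun z : Fin 5 → ℝ => (1 - z 1) / (z 1 + (1 - z 1) * z 0) := by fun_prop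
  exact h1.mul ((measurable_integrandJ p q).comp measurable_theta)

/-- The transformed integrand is non-negative on the cube. -/
theorem thetaIntegrand_nonneg (p : Fin 7 → ℤ) (q : Fin 5 → ℤ) {z : Fin 5 → ℝ} (hz : z ∈ openCube) :
    0 ≤ (1 - z 1) / (z 1 + (1 - z 1) * z 0) *
      integrandJ p q ![z 1 + (1 - z 1) * z 0, z 1 / (z 1 + (1 - z 1) * z 0), z 2, z 3, z 4] := by
  have h0 := hz 0; have h1 := hz 1
  obtain ⟨hY1, -⟩ := Y_bounds h0 h1
  exact mul_nonneg (div_pos (by linarith [h1.2]) (h1.1.trans hY1)).le (integrandJ_nonneg p q (theta_mem_openCube hz))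

/-! ### `p₁₂` beyond the chamber -/

/-- **`J` under `p₁₂` — for ALL parameters with `q₁, q₂, p₁+q₁−p₂, p₂+q₂−p₁ ≥ 0`** (no chamber, no sign
condition on `p₀,…,p₆` or `q₃,q₄,q₅`, no convergence hypothesis):
`J(p₁₂(p;q)) · q₁! q₂! = J(p;q) · (p₁+q₁−p₂)! (p₂+q₂−p₁)!`. [BrownZudilin2022, Sect. 7, the display for the
symmetry of `p₁+1`, `p₂+1`] — here from the fibration `Θ` over `P = y₁y₂` and `EulerKernelSymmetry.euler_symmetry`
in the fibre variable (with `α = P`, `β = 1 − P`), then Tonelli over `(P, y₃, y₄, y₅)`. -/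
theorem Jintegral_p12_core (p : Fin 7 → ℤ) (q : Fin 5 → ℤ) {n₁ n₂ m k : ℕ} (hq0 : q 0 = n₁) (hq1 : q 1 = n₂)
    (hm : p 2 + q 1 - p 1 = m) (hk : p 1 + q 0 - p 2 = k) :
    Jintegral ![p 0, p 2, p 1, p 3, p 4, p 5, p 6] ![p 1 + q 0 - p 2, p 2 + q 1 - p 1, q 2, q 3, q 4] *
        ((n₁ ! * n₂ ! : ℕ) : ℝ) =
      Jintegral p q * ((k ! * m ! : ℕ) : ℝ) := by
  set p' : Fin 7 → ℤ := ![p 0, p 2, p 1, p 3, p 4, p 5, p 6] with hp'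
  set q' : Fin 5 → ℤ := ![p 1 + q 0 - p 2, p 2 + q 1 - p 1, q 2, q 3, q 4] with hq'
  have hkm : k = n₂ + n₁ - m := by omega
  have hle : m ≤ n₂ + n₁ := by omega
  rw [mul_comm (Jintegral p' q'), mul_comm (Jintegral p q), Jintegral_theta p' q', Jintegral_theta p q]
  refine setIntegral_openCube_eq_of_slices (measurable_thetaIntegrand p' q') (measurable_thetaIntegrand p q)
    (fun z hz => thetaIntegrand_nonneg p' q' hz) (fun z hz => thetaIntegrand_nonneg p q hz)
    (by positivity) (by positivity) (fun x hx => ?_)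
  have hx0 := mem_cube4 hx 0; have hx1 := mem_cube4 hx 1; have hx2 := mem_cube4 hx 2; have hx3 := mem_cube4 hx 3
  have hα : 0 < x 0 := hx0.1
  have hβ : 0 ≤ 1 - x 0 := by linarith [hx0.2]
  -- the common factor and the two slices
  set R : ℝ := (x 1) ^ (p 3 + 1) * (1 - x 1) ^ (q 2) * (x 2) ^ (p 4) * (1 - x 2) ^ (q 3) * (x 3) ^ (p 5) *
      (1 - x 3) ^ (q 4) / (1 - x 1 * (1 - x 2 * x 3)) ^ (p 6 + 1) with hR
  have hq'0 : q' 0 = (k : ℤ) := by simp [hq', hk]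
  have hq'1 : q' 1 = (m : ℤ) := by simp [hq', hm]
  have hm' : p' 2 + q' 1 - p' 1 = (n₂ : ℤ) := by simp [hp', hq']; omega
  have hG : EqOn (fun s => (1 - Matrix.vecCons s x 1) / (Matrix.vecCons s x 1 + (1 - Matrix.vecCons s x 1) *
        Matrix.vecCons s x 0) * integrandJ p q ![Matrix.vecCons s x 1 + (1 - Matrix.vecCons s x 1) *
        Matrix.vecCons s x 0, Matrix.vecCons s x 1 / (Matrix.vecCons s x 1 + (1 - Matrix.vecCons s x 1) *
        Matrix.vecCons s x 0), Matrix.vecCons s x 2, Matrix.vecCons s x 3, Matrix.vecCons s x 4])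
      (fun s => R * ((x 0) ^ (p 2) * (1 - x 0) ^ (n₁ + n₂ + 1) / (1 - x 1 * (1 - x 0)) ^ (p 0 + 1)) *
        (s ^ n₂ * (1 - s) ^ n₁ / (x 0 + (1 - x 0) * s) ^ (m + 1))) (Ioo 0 1) := by
    intro s hs
    simp only [Matrix.cons_val_zero, Matrix.cons_val_one, Matrix.cons_val]
    rw [theta_integrand_coord p q hq0 hq1 hm s (x 0) (x 1) (x 2) (x 3) hs hx0]
  have hF : EqOn (fun s => (1 - Matrix.vecCons s x 1) / (Matrix.vecCons s x 1 + (1 - Matrix.vecCons s x 1) *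
        Matrix.vecCons s x 0) * integrandJ p' q' ![Matrix.vecCons s x 1 + (1 - Matrix.vecCons s x 1) *
        Matrix.vecCons s x 0, Matrix.vecCons s x 1 / (Matrix.vecCons s x 1 + (1 - Matrix.vecCons s x 1) *
        Matrix.vecCons s x 0), Matrix.vecCons s x 2, Matrix.vecCons s x 3, Matrix.vecCons s x 4])
      (fun s => R * ((x 0) ^ (p 1) * (1 - x 0) ^ (k + m + 1) / (1 - x 1 * (1 - x 0)) ^ (p 0 + 1)) *
        (s ^ m * (1 - s) ^ k / (x 0 + (1 - x 0) * s) ^ (n₂ + 1))) (Ioo 0 1) := by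
    intro s hs
    simp only [Matrix.cons_val_zero, Matrix.cons_val_one, Matrix.cons_val]
    rw [theta_integrand_coord p' q' hq'0 hq'1 hm' s (x 0) (x 1) (x 2) (x 3) hs hx0]
    simp [hp', hq', hR]
  refine ⟨?_, ?_, ?_⟩
  · exact (integrableOn_kernel _ hα hβ m k (n₂ + 1)).congr_fun hF.symm measurableSet_Ioo
  · exact (integrableOn_kernel _ hα hβ n₂ n₁ (m + 1)).congr_fun hG.symm measurableSet_Ioo
  · rw [setIntegral_congr_fun measurableSet_Ioo hF, setIntegral_congr_fun measurableSet_Ioo hG, integral_const_mul,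
      integral_const_mul, setIntegral_Ioo_eq_intervalIntegral, setIntegral_Ioo_eq_intervalIntegral]
    have hE := euler_symmetry m n₂ n₁ hle hα hβ
    rw [← hkm] at hE
    have hp1 : p 1 = p 2 + (n₂ : ℤ) - (m : ℤ) := by omega
    rw [hp1, zpow_sub₀ hα.ne', zpow_add₀ hα.ne', zpow_natCast, zpow_natCast,
      show k + m + 1 = n₁ + n₂ + 1 by omega]
    generalize (∫ s in (0:ℝ)..1, s ^ n₂ * (1 - s) ^ n₁ / (x 0 + (1 - x 0) * s) ^ (m + 1)) = I₁ at hE ⊢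
    generalize (∫ s in (0:ℝ)..1, s ^ m * (1 - s) ^ k / (x 0 + (1 - x 0) * s) ^ (n₂ + 1)) = I₂ at hE ⊢
    have hxa : (x 0) ^ (p 2) ≠ 0 := zpow_ne_zero _ hα.ne'
    have hxm : (x 0) ^ m ≠ 0 := pow_ne_zero _ hα.ne'
    have hD : (1 - x 1 * (1 - x 0)) ^ (p 0 + 1) ≠ 0 := by
      apply zpow_ne_zero
      nlinarith [mul_lt_mul'' hx1.2 (show 1 - x 0 < 1 by linarith) hx1.1.le hβ]
    generalize (x 0) ^ (p 2) = Pa at hxa ⊢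
    generalize (1 - x 1 * (1 - x 0)) ^ (p 0 + 1) = D at hD ⊢
    calc ((n₁ ! * n₂ ! : ℕ) : ℝ) * (R * (Pa * (x 0) ^ n₂ / (x 0) ^ m * (1 - x 0) ^ (n₁ + n₂ + 1) / D) * I₂)
        = R * Pa * (1 - x 0) ^ (n₁ + n₂ + 1) / D / (x 0) ^ m * ((n₂ ! : ℝ) * n₁ ! * (x 0) ^ n₂ * I₂) := by
          push_cast; field_simp
      _ = R * Pa * (1 - x 0) ^ (n₁ + n₂ + 1) / D / (x 0) ^ m * ((m ! : ℝ) * k ! * (x 0) ^ m * I₁) := by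
          rw [← hE]
      _ = ((k ! * m ! : ℕ) : ℝ) * (R * (Pa * (1 - x 0) ^ (n₁ + n₂ + 1) / D) * I₁) := by
          push_cast; field_simp

/-- **`J` under `p₁₂` beyond the chamber** — `J(p₁₂(p;q)) · q₁! q₂! = J(p;q) · (p₁+q₁−p₂)! (p₂+q₂−p₁)!` for all
parameter vectors with `q₁, q₂, p₁+q₁−p₂, p₂+q₂−p₁ ≥ 0` (the statement of `BarnesSymmetry.Jintegral_p12` without its
chamber hypothesis and without sign conditions on the other letters). [BrownZudilin2022, Sect. 7] -/
theorem Jintegral_p12 (p : Fin 7 → ℤ) (q : Fin 5 → ℤ) (hq0 : 0 ≤ q 0) (hq1 : 0 ≤ q 1) (h12 : 0 ≤ p 1 + q 0 - p 2)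
    (h21 : 0 ≤ p 2 + q 1 - p 1) :
    Jintegral ![p 0, p 2, p 1, p 3, p 4, p 5, p 6] ![p 1 + q 0 - p 2, p 2 + q 1 - p 1, q 2, q 3, q 4] *
        (((q 0).toNat ! * (q 1).toNat ! : ℕ) : ℝ) =
      Jintegral p q * ((((p 1 + q 0 - p 2).toNat ! * (p 2 + q 1 - p 1).toNat ! : ℕ)) : ℝ) :=
  Jintegral_p12_core p q (Int.toNat_of_nonneg hq0).symm (Int.toNat_of_nonneg hq1).symm
    (Int.toNat_of_nonneg h21).symm (Int.toNat_of_nonneg h12).symm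

/-- **`I` under `p₁₂` on the whole common domain of convergence**: `I(p₁₂ a)·q₁!q₂! = I(a)·(p₁+q₁−p₂)!(p₂+q₂−p₁)!`
(letters of `a`) for `a` and `p₁₂ a` convergent — no chamber hypothesis, `p₀(a) = h₁₉(a)` of either sign.
[BrownZudilin2022, Sect. 7] -/
theorem cellularIntegral_genP12 {a : Fin 8 → ℤ} (ha : Converges a) (hga : Converges (genP12 a)) :
    cellularIntegral (genP12 a) * (((qOf a 0).toNat ! * (qOf a 1).toNat ! : ℕ) : ℝ) =
      cellularIntegral a * ((((pOf a 1 + qOf a 0 - pOf a 2).toNat ! *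
        (pOf a 2 + qOf a 1 - pOf a 1).toNat ! : ℕ)) : ℝ) := by
  have hq0 : 0 ≤ qOf a 0 := by
    have := ha (a 3) (by simp [convergenceForms])
    simpa [qOf] using this
  have hq1 : 0 ≤ qOf a 1 := by
    have := ha (a 4) (by simp [convergenceForms])
    simpa [qOf] using this
  have h12 : 0 ≤ pOf a 1 + qOf a 0 - pOf a 2 := by
    have := hga (genP12 a 3) (by simp [convergenceForms])
    simp [pOf, qOf, genP12] at this ⊢; omega
  have h21 : 0 ≤ pOf a 2 + qOf a 1 - pOf a 1 := by
    have := hga (genP12 a 4) (by simp [convergenceForms])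
    simp [pOf, qOf, genP12] at this ⊢; omega
  rw [cellularIntegral_eq_Jintegral, cellularIntegral_eq_Jintegral, pOf_genP12, qOf_genP12]
  exact Jintegral_p12 (pOf a) (qOf a) hq0 hq1 h12 h21

/-- **(27) under `p₁₂` — the `p₁₂`-conjunct of the named fact `invariance_of_converges'`, unconditionally**:
for `a` and `p₁₂ a` convergent, `I(p₁₂ a)/∏_{i∈F} h_i(p₁₂ a)! = I(a)/∏_{i∈F} h_i(a)!` (no chamber hypothesis).
[BrownZudilin2022, Sect. 7, eq. (27)] -/
theorem normalisedIntegral'_genP12 {a : Fin 8 → ℤ} (ha : Converges a) (hga : Converges (genP12 a)) :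
    normalisedIntegral' (genP12 a) = normalisedIntegral' a := by
  have hI := cellularIntegral_genP12 ha hga
  have hP := normF_genP12 a
  have hc : (((qOf a 0).toNat ! * (qOf a 1).toNat ! : ℕ) : ℝ) ≠ 0 := by positivity
  unfold normalisedIntegral'
  rw [div_eq_div_iff (normF_pos _).ne' (normF_pos _).ne']
  refine mul_right_cancel₀ hc ?_
  linear_combination ((Fset.map fun i => ((hForm a i).toNat ! : ℝ)).prod) * hI - cellularIntegral a * hP

/-! ### The `i₁`-conjugates `p₄₅ = i₁p₁₂i₁`, `p₅₆ = i₁p₀₁i₁` on the `t`-side, beyond the chamber -/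

/-- **`J` under `p₄₅`** — `J(p₄₅(p;q))·q₄!q₅! = J(p;q)·(p₄+q₄−p₅)!(p₅+q₅−p₄)!` for all `(p;q)` with
`q₄, q₅, p₄+q₄−p₅, p₅+q₅−p₄ ≥ 0` (from `Jintegral_p12` at the reversed parameters and `CubicalForm.Jintegral_reverse`).
[BrownZudilin2022, Sect. 7] -/
theorem Jintegral_p45 (p : Fin 7 → ℤ) (q : Fin 5 → ℤ) (hq3 : 0 ≤ q 3) (hq4 : 0 ≤ q 4) (h45 : 0 ≤ p 4 + q 3 - p 5)
    (h54 : 0 ≤ p 5 + q 4 - p 4) :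
    Jintegral ![p 0, p 1, p 2, p 3, p 5, p 4, p 6] ![q 0, q 1, q 2, p 4 + q 3 - p 5, p 5 + q 4 - p 4] *
        (((q 3).toNat ! * (q 4).toNat ! : ℕ) : ℝ) =
      Jintegral p q * ((((p 4 + q 3 - p 5).toNat ! * (p 5 + q 4 - p 4).toNat ! : ℕ)) : ℝ) := by
  have h1 := Jintegral_p12 ![p 6, p 5, p 4, p 3, p 2, p 1, p 0] ![q 4, q 3, q 2, q 1, q 0]
    (by simpa using hq4) (by simpa using hq3) (by simpa using h54) (by simpa using h45)
  have h2 := Jintegral_reverse p q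
  have h3 := Jintegral_reverse ![p 0, p 1, p 2, p 3, p 5, p 4, p 6] ![q 0, q 1, q 2, p 4 + q 3 - p 5, p 5 + q 4 - p 4]
  simp only [Matrix.cons_val_zero, Matrix.cons_val_one, Matrix.cons_val] at h1 h3
  rw [h3, h2] at h1
  push_cast at h1 ⊢
  linear_combination h1

/-- **`J` under `p₅₆`** — `J(p₅₆(p;q))·p₅!q₅! = J(p;q)·p₆!(p₅+q₅−p₆)!` for all `(p;q)` with
`p₅, p₆, q₅, p₅+q₅−p₆ ≥ 0` (from `Jintegral_p01` at the reversed parameters). [BrownZudilin2022, Sect. 7] -/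
theorem Jintegral_p56 (p : Fin 7 → ℤ) (q : Fin 5 → ℤ) (h5 : 0 ≤ p 5) (h6 : 0 ≤ p 6) (hq4 : 0 ≤ q 4)
    (h56 : 0 ≤ p 5 + q 4 - p 6) :
    Jintegral ![p 0, p 1, p 2, p 3, p 4, p 6, p 5] ![q 0, q 1, p 5 + q 2 - p 6, q 3, p 5 + q 4 - p 6] *
        (((p 5).toNat ! * (q 4).toNat ! : ℕ) : ℝ) =
      Jintegral p q * ((((p 6).toNat ! * (p 5 + q 4 - p 6).toNat ! : ℕ)) : ℝ) := by
  have h1 := Jintegral_p01 ![p 6, p 5, p 4, p 3, p 2, p 1, p 0] ![q 4, q 3, q 2, q 1, q 0]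
    (by simpa using h6) (by simpa using h5) (by simpa using hq4) (by simpa using h56)
  have h2 := Jintegral_reverse p q
  have h3 := Jintegral_reverse ![p 0, p 1, p 2, p 3, p 4, p 6, p 5] ![q 0, q 1, p 5 + q 2 - p 6, q 3, p 5 + q 4 - p 6]
  simp only [Matrix.cons_val_zero, Matrix.cons_val_one, Matrix.cons_val] at h1 h3
  rw [h3, h2] at h1
  push_cast at h1 ⊢
  linear_combination h1

/-! ### (27) for the whole 'trivial' group `⟨i₁, p₀₁, p₁₂⟩` and the reduction of the named fact to `h, h'` -/

/-- **(27) for the generators `i₁, p₀₁, p₁₂` on the common domain of convergence — the first three conjuncts of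
the named fact `invariance_of_converges'`, verbatim and unconditionally.** [BrownZudilin2022, Sect. 7, eq. (27)] -/
theorem invariance_of_converges'_trivial_group (a : Fin 8 → ℤ) (ha : Converges a) :
    (Converges (genI1 a) → normalisedIntegral' (genI1 a) = normalisedIntegral' a) ∧
      (Converges (genP01 a) → normalisedIntegral' (genP01 a) = normalisedIntegral' a) ∧
      (Converges (genP12 a) → normalisedIntegral' (genP12 a) = normalisedIntegral' a) :=
  ⟨fun _ => CellularIntegralInvolution.normalisedIntegral'_genI1 a, fun h => normalisedIntegral'_genP01 ha h,
    fun h => normalisedIntegral'_genP12 ha h⟩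

/-- **Reduction of the named fact `invariance_of_converges'` to Bailey's two generators**: the invariance of (27)
under `G` on the common domain of convergence follows from its `h`- and `h'`-conjuncts alone (the generators that
Brown–Zudilin obtain from Bailey's `₇F₆` transformation, Sect. 7 second half); `i₁, p₀₁, p₁₂` are theorems.
[BrownZudilin2022, Sect. 7, eq. (27)] -/
theorem invariance_of_converges'_of_h_h'
    (hH : ∀ a : Fin 8 → ℤ, Converges a → Converges (genH a) → normalisedIntegral' (genH a) = normalisedIntegral' a)
    (hH' : ∀ a : Fin 8 → ℤ, Converges a → Converges (genH' a) →
      normalisedIntegral' (genH' a) = normalisedIntegral' a) :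
    invariance_of_converges' := fun a ha =>
  ⟨fun _ => CellularIntegralInvolution.normalisedIntegral'_genI1 a, fun h => normalisedIntegral'_genP01 ha h,
    fun h => normalisedIntegral'_genP12 ha h, hH a ha, hH' a ha⟩

end Summit.KontsevichZagierPeriods.Zeta5Search.JintegralEulerP12

end
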